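import Literature.Geometry.Lorentzian.ConformalChangeChart
import Literature.Geometry.Lorentzian.DalembertianNaturality
import Literature.Geometry.Lorentzian.Basic
import HarnessLib

/-!
# The conformal transformation law `R(φ⁴ g) = φ⁻⁵ (R(g) φ − 8 Δ_g φ)` on a `3`-manifold

Schoen–Yau, Comm. Math. Phys. 65 (1979), §2 Step 1 (p. 49): *"The well-known formula for the
scalar curvature `R̃` [of `d̃s² = φ⁴ ds²`] is `R̃ = φ⁻⁵(-8Δφ + Rφ)`"* — Aubin 1982, Ch. 6, §6.3,
eq. (1) (`4((n-1)/(n-2)) Δφ + Rφ = R' φ^{(n+2)/(n-2)}` for `g' = φ^{4/(n-2)} g`) at `n = 3`;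
Besse 1987, Thm. 1.159 f). This is the ingredient `hR`/`hconf` taken as an explicit hypothesis in
`ConformalScalarFlat.lean` (Cor. 3.1 of Schoen–Yau 1979), `ConformalScalarFlatSign.lean` and
`PositiveMassConformalProofs.lean` (Step 1 of the proof of their Thm. 1). Here it is **proved**,
for any two smooth metrics `g` (Riemannian) and `g' = φ⁴ g` on a `3`-manifold modelled on `E3`,
with the prelude's `scalarCurvature` and Laplace–Beltrami operator `dalembertian = tr_g Hess`:

* `PseudoRiemannianMetric.scalarCurvature_conformal_fourth_power` — `S(g')(x) =
  φ(x)⁻⁵ (S(g)(x) φ(x) − 8 □_g φ (x))` at every point;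
* `conformal_scalarCurvature_law` — the same statement in the exact shape of the hypothesis
  `hconf` of `exists_conformal_scalarPos_of_massNeg_of_ingredients`
  (`PositiveMassConformalProofs.lean`) and `hR` of
  `exists_conformal_negativeMass_of_conformalFactor` (`ConformalScalarFlat.lean`), so that those
  reductions can be fed this theorem.

## Proof

Fix `x`. The inverse of the chart at `x` is a local diffeomorphism `Φ : U → X` from the open
subset `U = (chart target) ⊆ E3` (`ChartInverse.*` below); scalar curvature and the wave operator
are natural under it (`scalarCurvature_comap`, `CurvatureNaturality.lean`; `dalembertian_comap`,
`DalembertianNaturality.lean`), the pulled-back metrics `Φ^*g'` and `Φ^*g` on `U` again differ by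
the factor `(φ ∘ Φ)⁴`, `Φ^*g` is positive definite so that `E3` has a `(Φ^*g)(u₀)`-orthonormal
basis (`exists_basis_orthonormal_of_posDef`), and on `U` the law is the chart computation
`OpensChart.scalarCurvature_conformalRepr_fourth_power` (`ConformalChangeChart.lean`).
Everything is proved; no named facts are introduced.

## References

* R. Schoen, S.-T. Yau, *On the proof of the positive mass conjecture in general relativity*,
  Comm. Math. Phys. 65 (1979) 45–76, §2 Step 1, p. 49.
* T. Aubin, *Nonlinear analysis on manifolds. Monge–Ampère equations*, Grundlehren 252,
  Springer 1982, Ch. 6, §6.3, eq. (1).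
* A. Besse, *Einstein Manifolds*, Springer 1987, Thm. 1.159.
* B. O'Neill, *Semi-Riemannian geometry*, Academic Press 1983, Ch. 3, Prop. 3.59.
-/

noncomputable section

-- instance search through the nested operator type `E3 →L[ℝ] E3 →L[ℝ] ℝ` of metric components
set_option maxSynthPendingDepth 3

open Bundle Set Function Filter Manifold TopologicalSpace Module
open scoped Manifold ContDiff Topology

namespace Literature.Geometry.Lorentzian

/-! ### The inverse chart as a local diffeomorphism from an open subset of the model space -/

namespace ChartInverse

variable {X : Type*} [TopologicalSpace X] [ChartedSpace E3 X] [IsManifold (𝓡 3) ∞ X] (x : X)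

/-- The inverse chart at `x`, as a map from the chart target (an open subset of `E3`), is smooth
(`contMDiffOn_chart_symm`). [folklore] -/
theorem contMDiff_symm :
    ContMDiff 𝓘(ℝ, E3) (𝓡 3) (∞ + 1)
      (fun u : (⟨(chartAt E3 x).target, (chartAt E3 x).open_target⟩ : Opens E3) ↦
        (chartAt E3 x).symm u) := by
  have h : ((∞ : ℕ∞ω) + 1) = ∞ := rfl
  rw [h]
  exact (contMDiffOn_chart_symm (I := 𝓡 3) (x := x) (n := ∞)).comp_contMDiff
    contMDiff_subtype_val fun u ↦ u.2

/-- The inverse chart is an immersion: it has the smooth left inverse `chartAt E3 x` near every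
point of its image. [folklore] -/
theorem injective_mfderiv_symm :
    ∀ u : (⟨(chartAt E3 x).target, (chartAt E3 x).open_target⟩ : Opens E3),
      Function.Injective (mfderiv 𝓘(ℝ, E3) (𝓡 3)
        (fun u : (⟨(chartAt E3 x).target, (chartAt E3 x).open_target⟩ : Opens E3) ↦
          (chartAt E3 x).symm u) u) := by
  set U : Opens E3 := ⟨(chartAt E3 x).target, (chartAt E3 x).open_target⟩ with hU
  set Φ : U → X := fun u ↦ (chartAt E3 x).symm u with hΦ
  set ψ : X → E3 := fun p ↦ chartAt E3 x p with hψ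
  intro u
  have hmem : Φ u ∈ (chartAt E3 x).source := (chartAt E3 x).map_target u.2
  have hΦd : MDifferentiableAt 𝓘(ℝ, E3) (𝓡 3) Φ u :=
    ((contMDiff_symm x).of_le le_self_add u).mdifferentiableAt (by simp)
  have hψd : MDifferentiableAt (𝓡 3) 𝓘(ℝ, E3) ψ (Φ u) :=
    (((contMDiffOn_chart (I := 𝓡 3) (x := x) (n := ∞)).contMDiffAt
      ((chartAt E3 x).open_source.mem_nhds hmem))).mdifferentiableAt (by simp)
  have hcomp : mfderiv 𝓘(ℝ, E3) 𝓘(ℝ, E3) (ψ ∘ Φ) u =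
      (mfderiv (𝓡 3) 𝓘(ℝ, E3) ψ (Φ u)).comp (mfderiv 𝓘(ℝ, E3) (𝓡 3) Φ u) :=
    mfderiv_comp u hψd hΦd
  have hid : ψ ∘ Φ = (Subtype.val : U → E3) := by
    funext u'
    exact (chartAt E3 x).right_inv u'.2
  have hval : mfderiv 𝓘(ℝ, E3) 𝓘(ℝ, E3) (Subtype.val : U → E3) u =
      ContinuousLinearMap.id ℝ E3 := by
    have := OpensChart.mfderiv_eq (U := U) (F := E3) u Subtype.val id (fun _ ↦ rfl)
      differentiableAt_id
    rw [fderiv_id] at this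
    exact this
  have hinj : Function.Injective
      ((mfderiv (𝓡 3) 𝓘(ℝ, E3) ψ (Φ u)).comp (mfderiv 𝓘(ℝ, E3) (𝓡 3) Φ u)) := by
    rw [← hcomp, hid, hval]
    exact fun v w h ↦ h
  have hinj' : Function.Injective
      (⇑(mfderiv (𝓡 3) 𝓘(ℝ, E3) ψ (Φ u)) ∘ ⇑(mfderiv 𝓘(ℝ, E3) (𝓡 3) Φ u)) := hinj
  exact hinj'.of_comp

/-- A smooth function on `X` read through the inverse chart (extended to all of `E3` by the
junk values of `(chartAt E3 x).symm`) is smooth at the points of the chart target. [folklore] -/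
theorem contDiffAt_comp_symm {φ : X → ℝ} (hφ : ContMDiff (𝓡 3) 𝓘(ℝ) ∞ φ) {u : E3}
    (hu : u ∈ (chartAt E3 x).target) :
    ContDiffAt ℝ ∞ (fun y : E3 ↦ φ ((chartAt E3 x).symm y)) u := by
  have hon : ContMDiffOn 𝓘(ℝ, E3) 𝓘(ℝ) ∞ (φ ∘ (chartAt E3 x).symm) (chartAt E3 x).target :=
    hφ.comp_contMDiffOn (contMDiffOn_chart_symm (I := 𝓡 3) (x := x) (n := ∞))
  have hat : ContMDiffAt 𝓘(ℝ, E3) 𝓘(ℝ) ∞ (φ ∘ (chartAt E3 x).symm) u :=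
    hon.contMDiffAt ((chartAt E3 x).open_target.mem_nhds hu)
  exact contMDiffAt_iff_contDiffAt.1 hat

end ChartInverse

/-! ### The transformation law on a `3`-manifold -/

namespace PseudoRiemannianMetric

/-- **The conformal transformation law of scalar curvature in dimension three.** Let `X` be a
`3`-manifold modelled on `E3`, `g` a smooth Riemannian metric and `g'` a smooth metric on its
tangent bundle (each with its Levi-Civita connection), and `φ` a smooth positive function with
`g' = φ⁴ g` pointwise. Then at every point
`S(g')(x) = φ(x)⁻⁵ (S(g)(x) φ(x) − 8 □_g φ (x))`,
`□_g = tr_g Hess` being the Laplace–Beltrami operator — Schoen–Yau 1979, p. 49: *"The well-known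
formula for the scalar curvature `R̃` is `R̃ = φ⁻⁵(-8Δφ + Rφ)`"*; Aubin 1982, Ch. 6, §6.3,
eq. (1) with `n = 3`; Besse 1987, Thm. 1.159 f). Proof: read everything in the chart at `x`
(naturality of `S` and `□` under the inverse chart, `scalarCurvature_comap`,
`dalembertian_comap`), where the pulled-back metrics differ by `(φ ∘ Φ)⁴` and the law is
`OpensChart.scalarCurvature_conformalRepr_fourth_power` in a `Φ^*g`-orthonormal basis of `E3`.
[cite: SchoenYauPMT1979, §2 Step 1 (p. 49)] -/
theorem scalarCurvature_conformal_fourth_power {X : Type*} [TopologicalSpace X]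
    [ChartedSpace E3 X] [IsManifold (𝓡 3) ∞ X]
    (g g' : PseudoRiemannianMetric (𝓡 3) ∞ E3 (TangentSpace (𝓡 3) : X → Type _))
    [g.HasLeviCivita] [g'.HasLeviCivita] {φ : X → ℝ} (hg : g.IsRiemannian)
    (hφ : ContMDiff (𝓡 3) 𝓘(ℝ) ∞ φ) (hpos : ∀ x : X, 0 < φ x)
    (hgg' : ∀ (x : X) (v w : TangentSpace (𝓡 3) x), g'.val x v w = φ x ^ 4 * g.val x v w)
    (x : X) :
    g'.scalarCurvature x =
      (φ x ^ 5)⁻¹ * (g.scalarCurvature x * φ x - 8 * g.dalembertian φ x) := by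
  -- the inverse chart at `x`
  set U : Opens E3 := ⟨(chartAt E3 x).target, (chartAt E3 x).open_target⟩ with hU
  set Φ : U → X := fun u ↦ (chartAt E3 x).symm u with hΦdef
  have hΦ : ContMDiff 𝓘(ℝ, E3) (𝓡 3) (∞ + 1) Φ := ChartInverse.contMDiff_symm x
  have hΦ' : ∀ u, Function.Injective (mfderiv 𝓘(ℝ, E3) (𝓡 3) Φ u) :=
    ChartInverse.injective_mfderiv_symm x
  have hdim : Module.finrank ℝ E3 = Module.finrank ℝ E3 := rfl
  have hpb : contMDiff_pullbackBilin (𝓡 3) X 𝓘(ℝ, E3) U ∞ := contMDiff_pullbackBilin_holds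
  set u₀ : U := ⟨chartAt E3 x x, (chartAt E3 x).map_source (mem_chart_source E3 x)⟩ with hu₀
  have hx : Φ u₀ = x := (chartAt E3 x).left_inv (mem_chart_source E3 x)
  -- the pulled-back metrics on `U`
  set gU := g.comap hpb Φ hΦ hΦ' hdim with hgU
  set gU' := g'.comap hpb Φ hΦ hΦ' hdim with hgU'
  haveI : gU.HasLeviCivita := gU.hasLeviCivita
  haveI : gU'.HasLeviCivita := gU'.hasLeviCivita
  -- naturality of `S` and `□`
  have hφ2 : ContMDiffAt (𝓡 3) 𝓘(ℝ) 2 φ (Φ u₀) := (hφ.of_le (WithTop.coe_le_coe.mpr le_top)) _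
  rw [← hx, ← g'.scalarCurvature_comap hpb hΦ hΦ' hdim u₀, ← g.scalarCurvature_comap hpb hΦ hΦ' hdim u₀,
    ← g.dalembertian_comap hpb hΦ hΦ' hdim hφ2]
  -- representatives on `E3`
  set G : E3 → E3 →L[ℝ] E3 →L[ℝ] ℝ := Function.extend (Subtype.val : U → E3)
    (fun y : U ↦ (gU.val y : E3 →L[ℝ] E3 →L[ℝ] ℝ)) (fun _ ↦ 0) with hGdef
  set ψ : E3 → ℝ := fun y ↦ φ ((chartAt E3 x).symm y) with hψdef
  have hG : ∀ y : U, gU.val y = G y := fun y ↦ by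
    rw [hGdef, Subtype.val_injective.extend_apply]
  have hψy : ∀ y : U, ψ y = φ (Φ y) := fun y ↦ rfl
  have hG' : ∀ y : U, gU'.val y = (ψ y ^ 4) • G y := by
    intro y
    ext v w
    change g'.val (Φ y) (mfderiv 𝓘(ℝ, E3) (𝓡 3) Φ y v) (mfderiv 𝓘(ℝ, E3) (𝓡 3) Φ y w) =
      ψ y ^ 4 * G y v w
    rw [hgg', ← hG y]
    rfl
  -- the conformal factor in the chart
  have hψs : ContDiffAt ℝ 2 ψ (u₀ : E3) :=
    (ChartInverse.contDiffAt_comp_symm x hφ u₀.2).of_le (WithTop.coe_le_coe.mpr le_top)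
  have hψ0 : ψ u₀ ≠ 0 := by
    rw [hψy]
    exact (hpos _).ne'
  -- a `(Φ^*g)(u₀)`-orthonormal basis of `E3`
  set B : LinearMap.BilinForm ℝ E3 := LinearMap.mk₂ ℝ (fun v w ↦ G u₀ v w)
    (fun v₁ v₂ w ↦ by rw [map_add (G u₀)]; rfl)
    (fun c v w ↦ by rw [map_smul (G u₀)]; rfl)
    (fun v w₁ w₂ ↦ map_add _ _ _)
    (fun c v w ↦ map_smul _ _ _) with hBdef
  have hBapp : ∀ v w, B v w = G u₀ v w := fun v w ↦ rfl
  have hBs : B.IsSymm := by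
    refine ⟨fun v w ↦ ?_⟩
    rw [hBapp, hBapp, ← hG]
    exact gU.symm u₀ v w
  have hBp : ∀ v : E3, v ≠ 0 → 0 < B v v := by
    intro v hv
    rw [hBapp, ← hG]
    change 0 < g.val (Φ u₀) (mfderiv 𝓘(ℝ, E3) (𝓡 3) Φ u₀ v) (mfderiv 𝓘(ℝ, E3) (𝓡 3) Φ u₀ v)
    refine hg _ _ fun h0 ↦ hv ?_
    exact hΦ' u₀ (h0.trans (map_zero _).symm)
  obtain ⟨β, hβ⟩ := OpensChart.exists_basis_orthonormal_of_posDef finrank_euclideanSpace_fin B hBs hBp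
  simp only [hBapp] at hβ
  -- the chart computation
  have key := OpensChart.scalarCurvature_conformalRepr_fourth_power hG (g' := gU') hG' u₀ hψs hψ0 β hβ
  have hfun : (fun y : U ↦ ψ y) = φ ∘ Φ := funext fun y ↦ hψy y
  rw [hfun, hψy] at key
  exact key

end PseudoRiemannianMetric

/-- **The conformal transformation law, in the shape of the hypothesis `hconf`/`hR`** of
`exists_conformal_scalarPos_of_massNeg_of_ingredients` (`PositiveMassConformalProofs.lean`) and
`exists_conformal_negativeMass_of_conformalFactor` (`ConformalScalarFlat.lean`): for every
`3`-manifold `X` modelled on `E3`, smooth metrics `g` (Riemannian) and `g'` on its tangent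
bundle with their Levi-Civita connections, and a smooth positive `φ` with `g' = φ⁴ g` pointwise,
`S(g') = φ⁻⁵ (S(g) φ − 8 □_g φ)` — Schoen–Yau 1979, p. 49 ("the well-known formula");
Aubin 1982, Ch. 6, §6.3, eq. (1) with `n = 3`. [cite: SchoenYauPMT1979, §2 Step 1 (p. 49)] -/
theorem conformal_scalarCurvature_law :
    ∀ (X : Type) [TopologicalSpace X] [ChartedSpace E3 X] [IsManifold (𝓡 3) ∞ X]
      (g g' : PseudoRiemannianMetric (𝓡 3) ∞ E3 (TangentSpace (𝓡 3) : X → Type _))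
      [g.HasLeviCivita] [g'.HasLeviCivita] (φ : X → ℝ),
      g.IsRiemannian → ContMDiff (𝓡 3) 𝓘(ℝ) ∞ φ → (∀ x : X, 0 < φ x) →
      (∀ (x : X) (v w : TangentSpace (𝓡 3) x), g'.val x v w = φ x ^ 4 * g.val x v w) →
      ∀ x : X, g'.scalarCurvature x =
        (φ x ^ 5)⁻¹ * (g.scalarCurvature x * φ x - 8 * g.dalembertian φ x) := by
  intro X _ _ _ g g' _ _ φ hg hφ hpos hgg' x
  exact PseudoRiemannianMetric.scalarCurvature_conformal_fourth_power g g' hg hφ hpos hgg' x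

end Literature.Geometry.Lorentzian

end
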